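import Summits.QuantumFields.BalabanUV.T4Continuum.Support.NE9CouplingHolomorphyLipschitz
import Summits.QuantumFields.BalabanUV.T4Continuum.Support.NE9CurveFromBackgroundMap
import Summits.QuantumFields.BalabanUV.T4Continuum.Support.NE9KernelSpeciesCoupling

/-!
# NE9SpeciesCouplingHolomorphy — leaf A3 for the CURVE species of Bałaban's shape and for the KERNEL species with the
# coupling-Lipschitz binder PRODUCED from holomorphy in the last coupling: `cpieceResponse_compCur` (CUR-BG, leaf-05-g5 p215194)
# and `cpieceResponse_ker` ∕ `channelCouplingModulus_ker` (A3-KER, leaf-09-g6 p214870) APPLIED BY NAME with (d2) `hlip` ∕ (K-Lip)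
# `hkerL` supplied by `NE9CouplingHolomorphyLipschitz.dirLip_of_holo` ∕ `kerLip_of_holo` at `clipd := 2∕ϱ` ∕ `λ := 2∕ϱ` (cell
# `pub-balaban`, T4-DAG §2 node U3 ∕ §6 NE9; NE9 formalisation swarm, unit `b2b-balaban-t4-ne9-formalise-leaf-03` gen 5;
# own-initiative lineage item «A3-HOL» part 2∕2, CLAIMS.log l.12175, at own risk)

HONEST FRAMING (T4-DAG PAGE 1).  Rung (B)+1 of the FINITE-VOLUME T⁴ programme — existence AND uniqueness of the ε → 0 limit
of gauge-invariant observables on a fixed torus; NOT infinite volume, NOT a mass gap, NOT the Clay problem.  NE9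
(`T4OutputRate.NE9` ∧ `FadingMemory`) is a cell NEW ESTIMATE, NOT PRINTED, and is NOT discharged here («NE9 ⇐ the named
binders»); spine 0∕9; 0∕18 skeleton leaves instantiated on Bałaban's objects (O-NE9-1).  HONEST DEPENDENCY (cell line,
verbatim): continuum YM on T⁴ ⇐ BetaPertH ∧ nine spine estimates (0/9 proved); BetaPertH ⇐ (D1) ∧ (D4) ∧ CAP+tail; G-an2-4
gates asym, D1 and NE2/3/4.  [I] = [Balaban1987RG1] (CMP **109**), [II] = [Balaban1988RG2Cluster] (CMP **116**) are quoted for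
TYPES only (ABSOLUTE RULE: nothing printed in the audited series is asserted).  No `def`, no Prop-valued definition (trigger
c3); `FlowStep.BetaPertH`, (B), (B^μ) do not occur.

WHERE THIS SITS (skeleton leaf A3 ∕ LEAVES.md instance row O-NE9-5).  Part 1 (`NE9CouplingHolomorphyLipschitz`) PRODUCES the two
coupling-Lipschitz binders of leaf A3 from [S1-c]-TYPE holomorphy-in-the-last-coupling binders with the constants `2∕ϱ`.  THIS FILE
plugs the producers into the two standing species-level A3 theorems, so that their binder lists read, on the coupling-regularity
line, HOLOMORPHY + SIZE ON THE DISC instead of a Lipschitz modulus with an unnamed constant: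
* §1 **`cpieceResponse_compCur_of_holo`** — CUR-BG's `cpieceResponse_compCur` (leaf A3's per-piece response for the curve species
  of Bałaban's shape `Dc := D.compCur Ψ R′`, [I] (3.34)∕(3.53)–(3.54)) with `hclipd`∕`hlip` REPLACED by `ϱ > 0` and the three part-1
  binders (res)∕(hol)∕(size) on a coupling-complexified shift-field direction `dirZ`; conclusion = CUR-BG's with **`clipd := 2∕ϱ`**
  (so `clip = 4·clipd = 8∕ϱ` at the curve and `qc = 64·(8∕ϱ)·N̄`).  Every other binder VERBATIM: `D.Admissible`, `0 < dirB`,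
  (Ψ1)–(Ψ3), analyticity + (1.18) of the family, (d1) `hcont`, `hhalf`, `0 < c_dir`, `0 < ℓ`.
* §2 **`cpieceResponse_ker_of_holo`** ∕ **`channelCouplingModulus_ker_of_holo`** — A3-KER's two theorems with `hlam`∕`hkerL` REPLACED
  by `ϱ > 0` and part 1's (res)∕(hol)∕(K-on-the-disc) on a coupling-complexified summand `kerZ`; conclusions = A3-KER's with
  **`λ := 2∕ϱ`** (`qc = (2∕ϱ)·N̄`, `qT = (2∕ϱ)·N̄·c_Q·(1 − ω)⁻¹`).  Every other binder VERBATIM: `K.Admissible`, analyticity + (1.18),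
  (C) `hkerC`, the level counts at `κ − w`, scalars.
The RAY species (abelian sub-case, OWNER RULE l.9603) needs no theorem of its own: `cpieceResponse_rem … (dirLip_of_holo D hϱ dirZ
hres hhol hsize)` is the one-term instance.  NOT PRINTED and not claimed: that Bałaban's (1.23) directions, background maps or §4
kernels meet any binder (O-NE9-1 ∕ O-NE9-5).  DISGUISE TEST: last coupling only, the SAME old terms at two histories, one species
at a time — no history comparison of terms; not NE9.

WHAT IS PROVED (kernel, `[folklore]`-level composition BY NAME; 0 sorry, 0 `def`): §1 `cpieceResponse_compCur_of_holo`;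
§2 `cpieceResponse_ker_of_holo`, `channelCouplingModulus_ker_of_holo`.

References (TYPES only): [Balaban1987RG1] T. Bałaban, CMP **109** (1987) 249–301 — (2.12) p. 268, (3.2) p. 270, (3.36)–(3.37)
p. 277, (3.53)–(3.54) p. 280, (4.21)–(4.22) pp. 285–286; [Balaban1988RG2Cluster] T. Bałaban, CMP **116** (1988) 1–22 — (1.21)–(1.25)
p. 7, (1.33)–(1.36) p. 9, Lemma 2 p. 11.  Summits-side NEW work (LEAN PLACEMENT RULE); imports part 1, CUR-BG
`NE9CurveFromBackgroundMap` (p215194) and A3-KER `NE9KernelSpeciesCoupling` (p214870) BY NAME; modifies nothing; no END face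
re-wired (END-COMP `termSize_ne9_and_fadingMemory_compCur_margProj_cpieceForm` p215920 and the assembled-species ENDs take the
produced `hlip`∕`hkerL` by one `exact` — the owner ∕ leaf-05 ∕ leaf-06 lineages' call).  Value = leaf A3's coupling-regularity inputs
for both species families stated as route P1's [S1-c]-TYPE premise with explicit constants, NOT summit progress.
-/

noncomputable section

namespace Summit.QuantumFields.BalabanUV.T4Continuum.NE9SpeciesCouplingHolomorphy

open scoped BigOperators
open Metric Set Complex
open Literature.MathematicalPhysics.QuantumFieldTheory.Balaban1983to89
open Literature.MathematicalPhysics.QuantumFieldTheory.Balaban1983to89.T4OutputRate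
open Literature.MathematicalPhysics.QuantumFieldTheory.Balaban1983to89.T4HistoryLipschitzRecursion
open Literature.MathematicalPhysics.QuantumFieldTheory.Balaban1983to89.T4HistoryLipschitzSegment
open Summit.QuantumFields.BalabanUV.T4Continuum.NE9Lemma1Counting
open Summit.QuantumFields.BalabanUV.T4Continuum.NE9Lemma1Gain
open Summit.QuantumFields.BalabanUV.T4Continuum.NE9Lemma1PieceClass
open Summit.QuantumFields.BalabanUV.T4Continuum.NE9Lemma1RemainderSpecies
open Summit.QuantumFields.BalabanUV.T4Continuum.NE9Lemma1CurveSpecies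
open Summit.QuantumFields.BalabanUV.T4Continuum.NE9Lemma1KernelSpecies
open Summit.QuantumFields.BalabanUV.T4Continuum.NE9ComplexEncoding (doubleCarriers)
open Summit.QuantumFields.BalabanUV.T4Continuum.NE9CouplingHolomorphyLipschitz (dirLip_of_holo kerLip_of_holo two_div_nonneg)
open Summit.QuantumFields.BalabanUV.T4Continuum.NE9CurveFromBackgroundMap (cpieceResponse_compCur)
open Summit.QuantumFields.BalabanUV.T4Continuum.NE9KernelSpeciesCoupling (cpieceResponse_ker channelCouplingModulus_ker)

/-! ## §1 The curve species of Bałaban's shape: leaf A3 with (d2) produced from holomorphy -/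

section Curve

variable {C : Carriers} {E : Type} {ι α β γ δ : Type} [NormedAddCommGroup E] [NormedSpace ℂ E] [DecidableEq δ]

/-- **LEAF A3 FOR THE CURVE SPECIES OF BAŁABAN'S SHAPE, (d2) PRODUCED FROM HOLOMORPHY IN THE LAST COUPLING** — CUR-BG's
`cpieceResponse_compCur` APPLIED BY NAME with `hlip := dirLip_of_holo D hϱ dirZ hres hhol hsize` and `hclipd := two_div_nonneg hϱ`;
conclusion = CUR-BG's at `clipd := 2∕ϱ`.  DISPLAYED: the ray datum's `D.Admissible ℓ c_dir d₀` + `0 < dirB` ([I] (3.36) p. 277, [II]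
(1.25) p. 7 — TYPE), the background-map TYPE facts (Ψ1) analytic on the field ball ∕ (Ψ2) into the chart ball ∕ (Ψ3) `Ψ_X 0 = 0` ([I]
(3.37) p. 277, Lemma 4 (3.53) p. 280), analyticity + (1.18) `TermSize` of the family, (d1) contour continuity of the shift-field
direction, and — replacing (d2) — a coupling-complexified direction `dirZ` with (res) restriction on `W`, (hol) holomorphy on the
ϱ-discs `|ζ − g k| < ϱ`, (size) the (3.36)-TYPE relative size `≤ c_dir·ℓ k j·R_X` on those discs (route P1's [S1-c] TYPE: [I] (2.12)
p. 268 ∘ [II] Lemma 2 p. 11); `hhalf`, `0 < c_dir`, `0 < ℓ`.  Asserted for nothing of Bałaban's.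
[cite: Balaban1987RG1, (2.12) p.268, (3.36)-(3.37) p.277, (3.53)-(3.54) p.280; Balaban1988RG2Cluster, (1.21)-(1.25) p.7, Lemma 2 p.11] -/
theorem cpieceResponse_compCur_of_holo {D : RemData C E ι α β γ δ} {ℓ : ℕ → ℕ → ℝ} {cdir d0 : ℝ} (hD : D.Admissible ℓ cdir d0)
    (hpos : ∀ k s y a b x, 0 < D.dirB k s y a b x) {Ψ : C.Dom → E → E} {R' : C.Dom → ℝ}
    (hΨan : ∀ X, DifferentiableOn ℂ (Ψ X) (ball 0 (D.R X))) (hΨmaps : ∀ X, MapsTo (Ψ X) (ball 0 (D.R X)) (ball 0 (R' X)))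
    (hΨ0 : ∀ X, Ψ X 0 = 0)
    {Ef : Functional (doubleCarriers C) E} {W : Set (ℕ → ℝ)} {κ : ℝ} {N : ℕ → ℝ} {Nbar : ℝ}
    (hE : ∀ g ∈ W, Ef g ∈ analyticClass R') (hT : TermSize Ef W κ N) (hN0 : ∀ j, 0 ≤ N j) (hNb : ∀ j, N j ≤ Nbar)
    (hcdir : 0 < cdir) (hℓ : ∀ k j, 0 < ℓ k j) (hhalf : ∀ k j, cdir * ℓ k j < 1 / 2)
    (hcont : ∀ (k : ℕ) (s : ℕ → ℝ) (y : ι) (a : α) (b : β) (x : (doubleCarriers C).Dom),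
      ContinuousOn (fun p : ℂ × ((δ → ℝ) × (δ → ℂ)) => D.dir k s y a b x p.1 p.2.1 p.2.2)
        (sphere (0:ℂ) (D.r k) ×ˢ {q | OnContour D.κ₁ (D.cubes k y a b) q.1 q.2}))
    {ϱ : ℝ} (hϱ : 0 < ϱ) (dirZ : ℕ → ℂ → ι → α → β → (doubleCarriers C).Dom → ℂ → (δ → ℝ) → (δ → ℂ) → E)
    (hres : ∀ g ∈ W, ∀ (k : ℕ) (y : ι), ∀ a ∈ D.S0 k y, ∀ b ∈ D.SY k y a, ∀ (j : ℕ), ∀ x ∈ D.src k y a j,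
      ∀ t ∈ sphere (0:ℂ) (D.r k), ∀ (s' : δ → ℝ) (σ' : δ → ℂ), OnContour D.κ₁ (D.cubes k y a b) s' σ' →
        D.dir k g y a b x t s' σ' = dirZ k (g k : ℂ) y a b x t s' σ')
    (hhol : ∀ g ∈ W, ∀ (k : ℕ) (y : ι), ∀ a ∈ D.S0 k y, ∀ b ∈ D.SY k y a, ∀ (j : ℕ), ∀ x ∈ D.src k y a j,
      ∀ t ∈ sphere (0:ℂ) (D.r k), ∀ (s' : δ → ℝ) (σ' : δ → ℂ), OnContour D.κ₁ (D.cubes k y a b) s' σ' →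
        DifferentiableOn ℂ (fun ζ : ℂ => dirZ k ζ y a b x t s' σ') (ball (g k : ℂ) ϱ))
    (hsize : ∀ g ∈ W, ∀ (k : ℕ) (y : ι), ∀ a ∈ D.S0 k y, ∀ b ∈ D.SY k y a, ∀ (j : ℕ), ∀ x ∈ D.src k y a j,
      ∀ t ∈ sphere (0:ℂ) (D.r k), ∀ (s' : δ → ℝ) (σ' : δ → ℂ), OnContour D.κ₁ (D.cubes k y a b) s' σ' →
        ∀ ζ ∈ ball (g k : ℂ) ϱ, ‖dirZ k ζ y a b x t s' σ'‖ ≤ cdir * ℓ k j * D.R x.1) :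
    ∀ g ∈ W, ∀ g' ∈ W, ∀ (k : ℕ) (y : ι), ∀ a ∈ (D.compCur Ψ R').toC.S0 k y, ∀ b ∈ (D.compCur Ψ R').toC.SY k y a,
      ∀ (j : ℕ), ∀ x ∈ (D.compCur Ψ R').toC.src k y a j,
      |(D.compCur Ψ R').toC.piece k g y a b x (Ef g) - (D.compCur Ψ R').toC.piece k g' y a b x (Ef g)| ≤
        (D.compCur Ψ R').Kp cdir k y * (64 * (4 * (2 / ϱ)) * Nbar) * ℓ k j ^ 5 * Real.exp (-(κ * (doubleCarriers C).d x)) *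
          Real.exp (-(1 / 8) * ((D.compCur Ψ R').κ₁ - 1) * (D.compCur Ψ R').toC.dY k y + (1 / 8) * (D.compCur Ψ R').κ₁ * d0 -
            (1 / 2) * ((D.compCur Ψ R').κ₁ - 1) * (D.compCur Ψ R').toC.vol k y a b) *
            |g k - g' k| :=
  cpieceResponse_compCur hD hpos hΨan hΨmaps hΨ0 hE hT hN0 hNb (two_div_nonneg hϱ) hcdir hℓ hhalf hcont
    (dirLip_of_holo D hϱ dirZ hres hhol hsize)

end Curve

/-! ## §2 The kernel species: leaf A3 with (K-Lip) produced from holomorphy -/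

section Kernel

variable {C : Carriers} {E : Type} {ι α β γ δ Pt : Type} [NormedAddCommGroup E] [NormedSpace ℂ E] [DecidableEq δ]

/-- **THE PER-PIECE COUPLING RESPONSE OF THE KERNEL SPECIES, (K-Lip) PRODUCED FROM HOLOMORPHY IN THE LAST COUPLING** — A3-KER's
`cpieceResponse_ker` APPLIED BY NAME with `hkerL := kerLip_of_holo K hϱ kerZ hres hhol hKdisc` and `hlam := two_div_nonneg hϱ`;
conclusion = A3-KER's at `λ := 2∕ϱ`.  DISPLAYED: `K.Admissible …` ((K)∕(G)∕(S), [I] (4.22) p. 286 — TYPE ∕ PROOF-INTERIOR), analyticity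
+ (1.18) of the family, (C) `hkerC`, and — replacing (K-Lip) — a coupling-complexified summand `kerZ` with (res) restriction on `W`
([I] (3.2) p. 270), (hol) holomorphy on `|ζ − g k| < ϱ` for analytic `F` ([I] (2.12) p. 268 — route P1's [S1-c] TYPE), (K-on-the-disc)
the p. 286 summand bound with the SAME letters on those discs.  Asserted for nothing of Bałaban's.
[cite: Balaban1987RG1, (2.12) p.268, (3.2) p.270, (4.21)-(4.22) pp.285-286; Balaban1988RG2Cluster, (1.21)-(1.25) p.7] -/
theorem cpieceResponse_ker_of_holo {K : KerData C E ι α β γ δ Pt} {ℓ gain : ℕ → ℕ → ℝ} {cK δ₀ δ₁ w w0 c0 c1 d0 : ℝ}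
    (hK : K.Admissible ℓ gain cK δ₀ δ₁ w w0 c0 c1 d0)
    {Ef : Functional (doubleCarriers C) E} {W : Set (ℕ → ℝ)} {κ : ℝ} {N : ℕ → ℝ} {Nbar : ℝ}
    (hE : ∀ g ∈ W, Ef g ∈ analyticClass K.R) (hT : TermSize Ef W κ N) (hN0 : ∀ j, 0 ≤ N j) (hNb : ∀ j, N j ≤ Nbar)
    (hkerC : ∀ (k : ℕ) (s : ℕ → ℝ) (y : ι) (a : α) (b : β) (x : (doubleCarriers C).Dom), ∀ p ∈ K.pts k y a,
      ∀ q ∈ K.pts k y a, ∀ F : E → ℂ, DifferentiableOn ℂ F (ball 0 (K.R x.1)) →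
        Continuous fun wv : ℂ × (δ → ℝ) × (δ → ℂ) => K.ker k s y a b x wv.1 wv.2.1 wv.2.2 p q F)
    {ϱ : ℝ} (hϱ : 0 < ϱ)
    (kerZ : ℕ → ℂ → ι → α → β → (doubleCarriers C).Dom → ℂ → (δ → ℝ) → (δ → ℂ) → Pt → Pt → (E → ℂ) → ℂ)
    (hres : ∀ g ∈ W, ∀ (k : ℕ) (y : ι), ∀ a ∈ K.S0 k y, ∀ b ∈ K.SY k y a, ∀ (j : ℕ), ∀ x ∈ K.src k y a j,
      ∀ t ∈ sphere (0:ℂ) (K.r k), ∀ (s' : δ → ℝ) (σ' : δ → ℂ), OnContour K.κ₁ (K.cubes k y a b) s' σ' →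
        ∀ p ∈ K.pts k y a, ∀ q ∈ K.pts k y a, ∀ F : E → ℂ, DifferentiableOn ℂ F (ball 0 (K.R x.1)) →
          K.ker k g y a b x t s' σ' p q F = kerZ k (g k : ℂ) y a b x t s' σ' p q F)
    (hhol : ∀ g ∈ W, ∀ (k : ℕ) (y : ι), ∀ a ∈ K.S0 k y, ∀ b ∈ K.SY k y a, ∀ (j : ℕ), ∀ x ∈ K.src k y a j,
      ∀ t ∈ sphere (0:ℂ) (K.r k), ∀ (s' : δ → ℝ) (σ' : δ → ℂ), OnContour K.κ₁ (K.cubes k y a b) s' σ' →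
        ∀ p ∈ K.pts k y a, ∀ q ∈ K.pts k y a, ∀ F : E → ℂ, DifferentiableOn ℂ F (ball 0 (K.R x.1)) →
          DifferentiableOn ℂ (fun ζ : ℂ => kerZ k ζ y a b x t s' σ' p q F) (ball (g k : ℂ) ϱ))
    (hKdisc : ∀ g ∈ W, ∀ (k : ℕ) (y : ι), ∀ a ∈ K.S0 k y, ∀ b ∈ K.SY k y a, ∀ (j : ℕ), ∀ x ∈ K.src k y a j,
      ∀ t ∈ sphere (0:ℂ) (K.r k), ∀ (s' : δ → ℝ) (σ' : δ → ℂ), OnContour K.κ₁ (K.cubes k y a b) s' σ' →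
        ∀ p ∈ K.pts k y a, ∀ q ∈ K.pts k y a, ∀ (F : E → ℂ) (M : ℝ),
          DifferentiableOn ℂ F (ball 0 (K.R x.1)) → (∀ z ∈ ball (0:E) (K.R x.1), ‖F z‖ ≤ M) →
            ∀ ζ ∈ ball (g k : ℂ) ϱ, ‖kerZ k ζ y a b x t s' σ' p q F‖ ≤
              cK * M * gain k j * K.ρd p q ^ K.m * Real.exp (-(δ₀ * (K.dX x.1 p + K.dX x.1 q)))) :
    ∀ g ∈ W, ∀ g' ∈ W, ∀ (k : ℕ) (y : ι), ∀ a ∈ K.toC.S0 k y, ∀ b ∈ K.toC.SY k y a, ∀ (j : ℕ), ∀ x ∈ K.toC.src k y a j,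
      |K.toC.piece k g y a b x (Ef g) - K.toC.piece k g' y a b x (Ef g)| ≤
        K.Kp cK w0 c0 c1 k y * (2 / ϱ * Nbar) * gain k j * Real.exp (-((κ - w) * (doubleCarriers C).d x)) *
          Real.exp (-(1 / 8) * (K.κ₁ - 1) * K.toC.dY k y + (1 / 8) * K.κ₁ * d0 - (1 / 2) * (K.κ₁ - 1) * K.toC.vol k y a b) *
            |g k - g' k| :=
  cpieceResponse_ker hK hE hT hN0 hNb (two_div_nonneg hϱ) hkerC (kerLip_of_holo K hϱ kerZ hres hhol hKdisc)

/-- **LEAF A3 (`hTcup`) FOR THE KERNEL SPECIES' CHANNEL, (K-Lip) PRODUCED FROM HOLOMORPHY IN THE LAST COUPLING** — A3-KER's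
`channelCouplingModulus_ker` APPLIED BY NAME with `hkerL := kerLip_of_holo …`, `hlam := two_div_nonneg hϱ`; conclusion = A3-KER's at
`λ := 2∕ϱ`: the END's `hTcup` for `T := cpieceChannel K.toC` with the S5 weight and the k-uniform **`qT := (2∕ϱ)·N̄·c_Q·(1 − ω)⁻¹`**
(k-uniform iff ϱ is, in the currency of `W` — trigger c5).  DISPLAYED as in `cpieceResponse_ker_of_holo`, plus the level counts at
`κ − w` and the scalars. [cite: Balaban1988RG2Cluster, (1.21)-(1.29) pp.7-8, (1.36) p.9; Balaban1987RG1, (2.12) p.268, (4.22) p.286] -/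
theorem channelCouplingModulus_ker_of_holo {K : KerData C E ι α β γ δ Pt} {ℓ gain : ℕ → ℕ → ℝ}
    {cK δ₀ δ₁ w w0 c0 c1 d0 : ℝ} (hK : K.Admissible ℓ gain cK δ₀ δ₁ w w0 c0 c1 d0)
    {Ef : Functional (doubleCarriers C) E} {W : Set (ℕ → ℝ)} {κ : ℝ} {N : ℕ → ℝ} {Nbar O1 cQ ω : ℝ}
    (hE : ∀ g ∈ W, Ef g ∈ analyticClass K.R) (hT : TermSize Ef W κ N) (hN0 : ∀ j, 0 ≤ N j) (hNb : ∀ j, N j ≤ Nbar)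
    (hkerC : ∀ (k : ℕ) (s : ℕ → ℝ) (y : ι) (a : α) (b : β) (x : (doubleCarriers C).Dom), ∀ p ∈ K.pts k y a,
      ∀ q ∈ K.pts k y a, ∀ F : E → ℂ, DifferentiableOn ℂ F (ball 0 (K.R x.1)) →
        Continuous fun wv : ℂ × (δ → ℝ) × (δ → ℂ) => K.ker k s y a b x wv.1 wv.2.1 wv.2.2 p q F)
    {ϱ : ℝ} (hϱ : 0 < ϱ)
    (kerZ : ℕ → ℂ → ι → α → β → (doubleCarriers C).Dom → ℂ → (δ → ℝ) → (δ → ℂ) → Pt → Pt → (E → ℂ) → ℂ)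
    (hres : ∀ g ∈ W, ∀ (k : ℕ) (y : ι), ∀ a ∈ K.S0 k y, ∀ b ∈ K.SY k y a, ∀ (j : ℕ), ∀ x ∈ K.src k y a j,
      ∀ t ∈ sphere (0:ℂ) (K.r k), ∀ (s' : δ → ℝ) (σ' : δ → ℂ), OnContour K.κ₁ (K.cubes k y a b) s' σ' →
        ∀ p ∈ K.pts k y a, ∀ q ∈ K.pts k y a, ∀ F : E → ℂ, DifferentiableOn ℂ F (ball 0 (K.R x.1)) →
          K.ker k g y a b x t s' σ' p q F = kerZ k (g k : ℂ) y a b x t s' σ' p q F)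
    (hhol : ∀ g ∈ W, ∀ (k : ℕ) (y : ι), ∀ a ∈ K.S0 k y, ∀ b ∈ K.SY k y a, ∀ (j : ℕ), ∀ x ∈ K.src k y a j,
      ∀ t ∈ sphere (0:ℂ) (K.r k), ∀ (s' : δ → ℝ) (σ' : δ → ℂ), OnContour K.κ₁ (K.cubes k y a b) s' σ' →
        ∀ p ∈ K.pts k y a, ∀ q ∈ K.pts k y a, ∀ F : E → ℂ, DifferentiableOn ℂ F (ball 0 (K.R x.1)) →
          DifferentiableOn ℂ (fun ζ : ℂ => kerZ k ζ y a b x t s' σ' p q F) (ball (g k : ℂ) ϱ))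
    (hKdisc : ∀ g ∈ W, ∀ (k : ℕ) (y : ι), ∀ a ∈ K.S0 k y, ∀ b ∈ K.SY k y a, ∀ (j : ℕ), ∀ x ∈ K.src k y a j,
      ∀ t ∈ sphere (0:ℂ) (K.r k), ∀ (s' : δ → ℝ) (σ' : δ → ℂ), OnContour K.κ₁ (K.cubes k y a b) s' σ' →
        ∀ p ∈ K.pts k y a, ∀ q ∈ K.pts k y a, ∀ (F : E → ℂ) (M : ℝ),
          DifferentiableOn ℂ F (ball 0 (K.R x.1)) → (∀ z ∈ ball (0:E) (K.R x.1), ‖F z‖ ≤ M) →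
            ∀ ζ ∈ ball (g k : ℂ) ϱ, ‖kerZ k ζ y a b x t s' σ' p q F‖ ≤
              cK * M * gain k j * K.ρd p q ^ K.m * Real.exp (-(δ₀ * (K.dX x.1 p + K.dX x.1 q))))
    (hL : LevelCountsG K.toC.frame (κ - w) K.κ₁ O1 cQ gain (agePow ω)) (hO1 : 0 ≤ O1) (hcQ : 0 ≤ cQ) (hω0 : 0 ≤ ω)
    (hω1 : ω < 1) :
    ∀ g ∈ W, ∀ g' ∈ W, ∀ (k : ℕ) (y : ι),
      |cpieceChannel K.toC k g (Ef g) y - cpieceChannel K.toC k g' (Ef g) y| ≤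
        weightOf K.toC.frame K.κ₁ d0 O1 (K.Kp cK w0 c0 c1) k y * (2 / ϱ * Nbar * cQ * (1 - ω)⁻¹ * |g k - g' k|) :=
  channelCouplingModulus_ker hK hE hT hN0 hNb (two_div_nonneg hϱ) hkerC (kerLip_of_holo K hϱ kerZ hres hhol hKdisc) hL hO1 hcQ
    hω0 hω1

end Kernel

end Summit.QuantumFields.BalabanUV.T4Continuum.NE9SpeciesCouplingHolomorphy

end
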